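import Summits.QuantumFields.YangMills.Theorems.BalabanUVNodesN10B13BondTowerInhabited
import Literature.MathematicalPhysics.QuantumFieldTheory.Balaban1983to89.Node00.Record12NumericsFamilyDict

/-!
# NODE N24 (B2) — LOCATED TYPING-STRENGTH CERTIFICATE: THE K1 FACE's N10 SOCKET IS INHABITED AS TYPED (by dag-n10-w3's explicit bond tower), AT EVERY FAMILY `F`

TRACK A (YM-PLAN §2d, node N24 of 28 = binder B2), seat `pub-ymgap-dag-n24-c` (R134 s2; gen 14).  Key of record K1⁹ = stmt-QuantumFields-27364 (`--kind proof --supports 27364 --as helper`,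
Summits lane; count-neutral).  [B13] = [Balaban1988RG2Cluster].

WHAT IS CERTIFIED (kernel, 1 theorem, 0 `def`, 0 `sorry`).  The K1 faces of record (this seat's p650613 → … → p680188 and their `…YP` editions) display NODE N10 as the socket
`h10 : ∀ F, ∃ lam13 : B12.RunParams → ResidB13 (stage3OfFamily F), ∀ P, B13LeafOfRecord (stage3OfFamily F) (lam13 P)` (p680188's door-free spelling; `(θZ).toStage3Params = stage3OfFamily F` is
`rfl`).  dag-n10-w3 g4's `N10B13BondTowerInhabited.b13LeafOfRecord_inhabited (θ : Stage3Params) (hL8 : 8 ≤ θ.ℓ₆ + 1) : ∃ lamD, B13LeafOfRecord θ lamD.toC.toK.layer` (the N10 junction of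
record applied NON-VACUOUSLY at an explicit decorated bond tower, K1⁸ helper) inhabits that socket AS TYPED at `θ := stage3OfFamily F` (`ℓ₆ + 1 = F.L ≥ 12`, [I] p. 251 «L > 11», `F.hL11`):
★ `N24_h10Socket_inhabited_asTyped`.

WHY THIS IS FILED AS A CERTIFICATE AND NOT KNITTED INTO THE FACE.  (i) In the engine of record (`Node00/N24Thm1Stage13RebindXWithB8PinB10YZW0SepCoPHG` §0 `thm1Printed_of_nodes11_of_rOperation` and its `Y₀`
twin) the [B13] leaf is NOT LOAD-BEARING: `Dag.B12_main`'s second component receives `b13` but at the record it is built from N09's Theorem-3 member `h09T : smallCouplings → smallFieldInductive`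
(`B12NodeKnitRecord8.b12_main_of_leaf_of_thm3Member`), and `Dag.B14_main ∕ B16`'s record closers read no `b13` — only the TRUTH of `(leavesP w P).b13` enters `DagBinding.Nodes`.  (ii) Hence the
K1 face's N10 socket, as typed, binds NEITHER N10's term of record (NODE 00's word per dag-n10-w3's own scope note) NOR any downstream use, and it is closable today by a tower that is not the
term of record.  Knitting that closure into the face would take N10 off the displayed bill without N10's discharge — a display the chair's VACUOUS-by-junk rulings (R445) reserve for a ruling,
not for a seat.  So: certificate here, socket kept displayed on the faces, the point REPORTED (LOCATED-SOCKET-N10: the load N10 carries in print — [II]'s bounds feeding [IV]/[III]'s small-field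
induction — sits inside N09's `h09T` at the K1 face, FLAG №7's row).

HONEST FRAMING.  Kernel bookkeeping (one `obtain` + one anonymous constructor); NO estimate; nothing of Bałaban's asserted beyond dag-n10-w3's landed theorem; N10 NOT discharged and NOT claimed;
no face edited; counts UNMOVED (typed 28∕28 · discharged 7∕27 · A 7∕28); K1⁹ HARD FREEZE respected; one finite 𝕋⁴ programme at fixed ε; R4 = the conditional finite-𝕋⁴ rung `BalabanLadder.UV`
only — NOT continuum ∕ ℝ⁴ ∕ OS ∕ mass gap ∕ Clay.  No `sorry`, `def`, `instance`, `notation`.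
-/

noncomputable section

namespace Summit.QuantumFields.YangMills.BalabanUVNodes.N24K1FaceN10SocketInhabitedAsTyped

open Literature.MathematicalPhysics.QuantumFieldTheory.Balaban1983to89
open Literature.MathematicalPhysics.QuantumFieldTheory.Balaban1983to89.Node00
open T4Continuum
open Summit.QuantumFields.YangMills.BalabanUVNodes.N10B13BondTowerInhabited (b13LeafOfRecord_inhabited)

/-- ★ **THE K1 FACE's N10 SOCKET IS INHABITED AS TYPED, AT EVERY FAMILY**: `∀ F, ∃ lam13 : B12.RunParams → ResidB13 (stage3OfFamily F), ∀ P, B13LeafOfRecord (stage3OfFamily F) (lam13 P)` —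
p680188's `h10` family VERBATIM — from dag-n10-w3's explicit bond-tower inhabitant `b13LeafOfRecord_inhabited` at `θ := stage3OfFamily F` (`(stage3OfFamily F).ℓ₆ + 1 = F.L ≥ 12` by
`F.hL11`), the run-constant residual `fun _ => lamD.toC.toK.layer`.  A LOCATED typing-strength certificate: the socket binds neither N10's term of record nor a downstream use (module
docstring); NOT a discharge of N10; not knitted into any face. [cite: Balaban1988RG2Cluster, Lemma 1 p.9, Lemma 2 p.11, Lemma 3 p.20, p.21 (closing paragraph); Balaban1987RG1, p.251 («L > 11»), p.253 (bookkeeping)] -/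
theorem N24_h10Socket_inhabited_asTyped (F : T4Family) :
    ∃ lam13 : B12.RunParams → ResidB13 (stage3OfFamily F), ∀ P : B12.RunParams, B13LeafOfRecord (stage3OfFamily F) (lam13 P) := by
  have hL : 8 ≤ (stage3OfFamily F).ℓ₆ + 1 := by
    have := F.hL11
    show 8 ≤ F.L - 1 + 1
    omega
  obtain ⟨lamD, h⟩ := b13LeafOfRecord_inhabited (stage3OfFamily F) hL
  exact ⟨fun _ => lamD.toC.toK.layer, fun _ => h⟩

end Summit.QuantumFields.YangMills.BalabanUVNodes.N24K1FaceN10SocketInhabitedAsTyped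

end
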